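import Mathlib
import HarnessLib
import Summits.CriticalPhenomena.Ising3DConformalLimit.Theses.MarkovRigidity
import Summits.CriticalPhenomena.Ising3DConformalLimit.Theorems.HyperoctahedralRPTwoPointKernelOfLimitClauses

/-!
# Route MarkovRigidity, support item `CubicSymmetryOfLimit` (stmt-CriticalPhenomena-6229):
# hyperoctahedral invariance of a pointwise scaling limit of the critical `ℤ³` Ising correlators

Statement (the route decl `…Theses.MarkovRigidity.CubicSymmetryOfLimit`, verbatim). For every
renormalisation `ρ > 0` on `(0,1]`, every `Δ` and every correlation family `S` on `ℝ³` which is the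
pointwise scaling limit of `criticalCorr 3` under `ρ`, normalised to `0` off `NonCoincident`, with
non-degenerate two-point function, translation invariant and scale covariant with dimension `Δ`, and
for every linear isometry `L` of `ℝ³` permuting the set `{±e_i}` (`L e_i = ±e_j`), one has
`S n (L ∘ x) = S n x` for all `n` and all configurations `x`.

Proof. (1) `signedPerm_of_single` — a linear isometry `L` of `ℝ³` with `L e_i ∈ {±e_0, ±e_1, ±e_2}`
for every `i` is a signed coordinate permutation: there are `π ∈ S₃` and signs `ε_j = ±1` with
`(L p)_j = ε_j p_{π⁻¹ j}`. Indeed, writing `L e_i = s_i e_{f i}`, the map `f` is injective because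
`L` preserves the inner products `⟪e_i, e_{i'}⟫ = δ_{ii'}` while `⟪s_i e_{f i}, s_{i'} e_{f i'}⟫ = ±1`
when `f i = f i'`; so `f` is a permutation `π` of `Fin 3`, and
`(L p)_j = ⟪e_j, L p⟫ = ⟪L⁻¹ e_j, p⟫ = ⟪s_{π⁻¹ j} e_{π⁻¹ j}, p⟫ = s_{π⁻¹ j} p_{π⁻¹ j}`.
(2) On non-coincident `x` the invariance `S n (L ∘ x) = S n x` is then the tree theorem
`HyperoctahedralRPTwoPoint.limit_signedPerm` (any pointwise limit of `criticalCorr 3` is invariant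
under signed coordinate permutations of `ℝ³`: coordinate permutations commute with the lattice
approximation and the critical plus state is `B₃`-invariant, `MoebiusLimitExistsNegative.limit_coordPerm`;
sign flips are absorbed after an irrational translation by the lattice symmetry "flip, then shift by
`-1`", `MoebiusLimitExistsNegative.limit_signFlip`, using the free translation invariance of any limit).
(3) Off `NonCoincident` both sides vanish by the normalisation hypothesis, since the injective `L`
preserves (non-)injectivity of configurations (`map_mem_nonCoincident_iff`).
Only the hypotheses "`S` is the limit" and "`S = 0` off `NonCoincident`" are used; positivity of `ρ`,
non-degeneracy, translation invariance and scale covariance of `S` are idle (translation invariance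
of a limit is automatic, `MoebiusLimitExistsNegative.limit_translate`).

References: S. Friedli, Y. Velenik, *Statistical Mechanics of Lattice Systems* (CUP 2017),
Exercise 3.14, p. 115 (lattice symmetries of the infinite-volume states); A. Björner, F. Brenti,
*Combinatorics of Coxeter Groups* (Springer 2005), §8.1 (`B₃` = signed permutations).
No definitions are introduced.
-/

noncomputable section

namespace Summit.CriticalPhenomena.Ising3DConformalLimit.MarkovRigidityCubicSymmetry

open Literature.Probability.LatticeModels
open Summit.CriticalPhenomena.Ising3DConformalLimit.MoebiusLimitExistsNegative
open Summit.CriticalPhenomena.Ising3DConformalLimit.Theses.MarkovRigidity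
open scoped InnerProductSpace

/-- **A linear isometry of `ℝ³` mapping each basis vector `e_i` to some `±e_j` is a signed coordinate
permutation**: there are `π ∈ S₃` and signs `ε_j ∈ {±1}` with `(L p)_j = ε_j · p_{π⁻¹ j}` for all
`p ∈ ℝ³` and all `j`. [cite: BjornerBrenti2005, §8.1, Prop. 8.1.5] -/
theorem signedPerm_of_single (L : EuclideanSpace ℝ (Fin 3) ≃ₗᵢ[ℝ] EuclideanSpace ℝ (Fin 3))
    (hL : ∀ i : Fin 3, ∃ j : Fin 3, L (EuclideanSpace.single i 1) = EuclideanSpace.single j 1 ∨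
      L (EuclideanSpace.single i 1) = -EuclideanSpace.single j 1) :
    ∃ (π : Equiv.Perm (Fin 3)) (ε : Fin 3 → ℤˣ), ∀ (p : EuclideanSpace ℝ (Fin 3)) (j : Fin 3),
      L p j = ((ε j : ℤ) : ℝ) * p (π.symm j) := by
  choose f hf using hL
  -- signs: `L e_i = s_i • e_{f i}`
  have hsign : ∀ i, ∃ u : ℤˣ,
      L (EuclideanSpace.single i 1) = ((u : ℤ) : ℝ) • EuclideanSpace.single (f i) (1:ℝ) := by
    intro i
    rcases hf i with h | h
    · exact ⟨1, by rw [h]; simp⟩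
    · exact ⟨-1, by rw [h]; simp⟩
  choose s hs using hsign
  have hss : ∀ i, ((s i : ℤ) : ℝ) * ((s i : ℤ) : ℝ) = 1 := fun i => by
    rcases Int.units_eq_one_or (s i) with h | h <;> simp [h]
  -- `f` is injective: `L` preserves `⟪e_i, e_{i'}⟫ = δ_{ii'}`
  have hinj : Function.Injective f := by
    intro i i' hii'
    by_contra hne
    have h0 : ⟪EuclideanSpace.single i (1:ℝ), EuclideanSpace.single i' (1:ℝ)⟫_ℝ = 0 := by
      rw [EuclideanSpace.inner_single_left, PiLp.single_apply, if_neg hne]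
      simp
    have h1 : ⟪L (EuclideanSpace.single i (1:ℝ)), L (EuclideanSpace.single i' (1:ℝ))⟫_ℝ = 0 := by
      rw [LinearIsometryEquiv.inner_map_map, h0]
    rw [hs i, hs i', hii', inner_smul_left, inner_smul_right, EuclideanSpace.inner_single_left,
      PiLp.single_apply, if_pos rfl] at h1
    rcases Int.units_eq_one_or (s i) with h | h <;>
      rcases Int.units_eq_one_or (s i') with h' | h' <;> simp [h, h'] at h1
  -- hence a permutation of `Fin 3`
  set π : Equiv.Perm (Fin 3) := Equiv.ofBijective f (Finite.injective_iff_bijective.1 hinj)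
  have hπf : ∀ i, π i = f i := fun i => rfl
  refine ⟨π, fun j => s (π.symm j), fun p j => ?_⟩
  have hj : f (π.symm j) = j := by rw [← hπf, Equiv.apply_symm_apply]
  -- `L⁻¹ e_j = s_{π⁻¹ j} • e_{π⁻¹ j}`
  have hsymm : L.symm (EuclideanSpace.single j (1:ℝ)) =
      ((s (π.symm j) : ℤ) : ℝ) • EuclideanSpace.single (π.symm j) (1:ℝ) := by
    apply L.injective
    rw [LinearIsometryEquiv.apply_symm_apply, map_smul, hs (π.symm j), smul_smul, hss, one_smul, hj]
  calc L p j = ⟪EuclideanSpace.single j (1:ℝ), L p⟫_ℝ := by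
        rw [EuclideanSpace.inner_single_left]; simp
    _ = ⟪L (L.symm (EuclideanSpace.single j (1:ℝ))), L p⟫_ℝ := by
        rw [LinearIsometryEquiv.apply_symm_apply]
    _ = ⟪L.symm (EuclideanSpace.single j (1:ℝ)), p⟫_ℝ := LinearIsometryEquiv.inner_map_map L _ _
    _ = ((s (π.symm j) : ℤ) : ℝ) * p (π.symm j) := by
        rw [hsymm, inner_smul_left, EuclideanSpace.inner_single_left]; simp

/-- **`CubicSymmetryOfLimit`** (item stmt-CriticalPhenomena-6229 of route MarkovRigidity): a
normalised pointwise scaling limit of the critical `ℤ³` Ising correlators is invariant under every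
linear isometry of `ℝ³` permuting `{±e_i}` (the hyperoctahedral group `B₃`). On `NonCoincident` this
is `HyperoctahedralRPTwoPoint.limit_signedPerm` after `signedPerm_of_single`; off `NonCoincident`
both sides vanish by the normalisation. [cite: FriedliVelenik2017, Exercise 3.14, p. 115] -/
theorem cubicSymmetryOfLimit_proof : CubicSymmetryOfLimit := by
  intro ρ Δ S _hρ hlim hzero _hnd _htr _hsc L hL n x
  obtain ⟨π, ε, hR⟩ := signedPerm_of_single L hL
  by_cases hx : x ∈ NonCoincident 3 n
  · exact HyperoctahedralRPTwoPoint.limit_signedPerm hlim π ε L hR hx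
  · rw [hzero n _ (mt (map_mem_nonCoincident_iff L x).1 hx), hzero n x hx]

end Summit.CriticalPhenomena.Ising3DConformalLimit.MarkovRigidityCubicSymmetry

end
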